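import Summits.Ventures.CertifiedManyBodySolver.Observables.SourcedOrderParameterFloorTTPrime
import Summits.Ventures.CertifiedManyBodySolver.Rows.SourcedTorusRows
import HarnessLib

/-!
# Pinning-field response menu (II): the ROW CLASS — response leaves at field `h` from certified sourced-energy rows by
# the Hellmann–Feynman CHORDS, the fast layer in `h`, and the honesty node (`t–t'`, finite torus, uniform in `L`)

HONEST FRAMING: first certified bounds on pairing observables; zero compute; nothing in this file is a number; every
bound-valued statement takes certified rows (the cells of `Rows/SourcedTorusRows`) as hypotheses; a finite-`h` response
floor/ceiling is symmetry-allowed and is NOT an order parameter and NOT a phase word (hubbard-cq WORDING W1: «finite-h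
response (certified)»); a ceiling never speaks to presence; not a superconductivity verdict.

Cell `hubbard-obs` (D-0042 / D-0082 (c-2)), seat `hubbard-obs-pin-1` (`prover-hubbard-obs-pin-1-g0-0`), row «pinning-field
response menu nodes — `h·(Δ_d + Δ_d†)` chords» = the T1 ROW CLASS of hubbard-cq START-HERE §3 («certified `d`-wave response
at field `h₀`») typed on the obs side (split of record 15:28Z). OBJECTS (tree): the pair-sourced grand-canonical `t–t'` torus
`A_L(h) = dWaveSourceTorusTT' L tp U μ h` (`DWaveSourceNNNHopping`), its tracial sourced pair density
`m_L(h) = dWaveSourceDensityTT' L tp U μ h` (`PinningFieldPairingOrder`; tree units), the ENERGY CELLS of cq-obsth-1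
`SourcedTorusEnergyLowerRow / UpperRow L tp U μ h e` (`e·L² ≤ E₀(A_L(h))`, resp. `≥`) and their uniform rows
`SourcedEnergyLowerRow / UpperRow tp U μ h q L₀ e` (every side `L ≥ L₀` with `q ∣ L`) — what a gauge-broken window
certificate (`dWaveSourceTorus_groundEnergy_ge_of_window_certificate[_d4]_eventually`; pilots `hubbard-cq-pilot-1/2`) resp. a
pinned trial state proves. THIS FILE:

* §1 the RESPONSE LEAVES (menu-node shapes) `PinFieldTorusResponseFloor / Ceiling L tp U μ h m` (`m ≤ m_L(h)`, resp. `≥`)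
  and the uniform rows `PinFieldResponseFloorAt / CeilingAt / WindowAt tp U μ h q L₀ m` (same side grammar as the energy
  cells); monotone transport in the slot / onset / side progression; the FAST LAYER IN `h` (`mono_field` / `anti_field`:
  floors move up, ceilings move down — `m_L` is non-decreasing); the a-priori floor `0` (`h ≥ 0`); consistency `m ≤ M`.
* §2 the two CHORDS at row level (factor-2 convention of record: `m_L = Re ω(Δ_d)/L²` is HALF of Koma–Tasaki's `m`):
  FLOOR `m ≤ m_L(h)` whenever `m·2(h − h₁) ≤ lo(h₁) − hi(h)` from a floor row at `h₁ < h` and a cap row AT `h`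
  (`PinFieldResponseFloorAt.of_energyRows`), CEILING `m_L(h) ≤ M` whenever `hi(h) − lo(h₂) ≤ M·2(h₂ − h)` from a cap row AT
  `h` and a floor row at `h₂ > h` (`PinFieldResponseCeilingAt.of_energyRows`), and the three-field MENU node
  (`PinFieldResponseWindowAt.of_menu`); one-torus forms `PinFieldTorusResponseFloor/Ceiling.of_energyRows`. Both edges are
  LINEAR in the energy slacks.
* §3 the fast layer in `h` for the ENERGY cells (`sourced[Torus]EnergyUpperRow_mono_field`: caps move UP in the field, so
  every source-free cap is a cap at every field; `…LowerRow_anti_field`: floors move DOWN) and the HONESTY NODE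
  `floorSlot_nonpos_of_transported_cap`: a floor chord fed with a cap inherited from a smaller field (in particular from
  `h = 0`) admits only `m ≤ 0` — the floor has teeth only with a cap of the SOURCED problem AT `h` certified strictly below
  the certified floor at `h₁` (a pinned variational state; the ask to the pilots / upper crew).

Tree-unit API used: cq-obsth-3's `DWaveSourceNNNHoppingOrderParameter` (sandwich `dWaveSourceDensityTT'_mul_le_groundEnergy_drop`,
`dWaveSourceDensityTT'_mono/_nonneg`, a-priori bound) and `SourcedOrderParameterFloorTTPrime` (the unnamed-window stair; the
readers in `PinningFieldMenuReaders.lean` re-key it to the named rows). Interface note: the energy cells are stated in `Rows/SourcedTorusRows` under the torus files' local instance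
`DecidableEq (FermionTorus 2 L) := LinearOrder.toDecidableEq`; this file works under the default instance and crosses once,
by `congr!` (`sourcedTorusEnergyLowerRow_iff` / `…UpperRow_iff`; the instances agree by `Subsingleton.elim`). At `tp = 0`
everything reduces to `dWaveSourceTorus` / `dWaveSourceDensity` (`dWaveSourceTorusTT'_zero_tp`, `dWaveSourceDensityTT'_zero`)
and agrees with cq-obsth-3's stair (`SourcedOrderParameterFloor`) and pin-2's brackets, which are not restated. No named
fact, no `sorry`; the only definitions are the five leaf shapes of §1.

References: T. Koma, H. Tasaki, J. Stat. Phys. 76 (1994) 745, §1 [KomaTasaki1994]; R. B. Griffiths, Phys. Rev. 152 (1966)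
240, §II [Griffiths1966]; M. Qin et al., PRX 10 (2020) 031016, eq. (6) (the printed Hellmann–Feynman measurement) [QinEtAl2020].
-/

noncomputable section

namespace Summit.Ventures.CertifiedManyBodySolver.Observables

open Matrix Literature.MathematicalPhysics.QuantumLattice Literature.Probability.LatticeModels
open Literature.Barriers.HubbardSuperconductivity
open Filter Topology Finset
open scoped Matrix.Norms.L2Operator ComplexOrder BigOperators

open Summit.Ventures.CertifiedManyBodySolver

/-! ### §1 Response leaves (menu-node shapes for the finite-field response) -/

section Leaves

/-- **Response FLOOR cell, one torus**: `m ≤ m_L(h)`, `m_L(h) = dWaveSourceDensityTT' L tp U μ h` the sourced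
`d`-wave pair density (tree units: `Re ω_h(Δ_d)/L²`, HALF of Koma–Tasaki's `m`, FOUR times the printed per-bond
`Δ_d` of Qin/Xu at printed field `h_d = 4h` — `PinningFieldPairingOrder.pinningFieldPairingOrder_eq`).
A finite-`h` response is symmetry-allowed; it is NOT an order parameter. [cite: KomaTasaki1994, §1] -/
def PinFieldTorusResponseFloor (L : ℕ) [NeZero L] (tp U μ h : ℝ) (m : ℚ) : Prop :=
  ((m : ℚ) : ℝ) ≤ dWaveSourceDensityTT' L tp U μ h

/-- **Response CEILING cell, one torus**: `m_L(h) ≤ M`. [cite: KomaTasaki1994, §1] -/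
def PinFieldTorusResponseCeiling (L : ℕ) [NeZero L] (tp U μ h : ℝ) (M : ℚ) : Prop :=
  dWaveSourceDensityTT' L tp U μ h ≤ ((M : ℚ) : ℝ)

/-- **Response FLOOR leaf at field `h`** (row shape of `Rows/SourcedTorusRows`: every side `L ≥ L₀` with `q ∣ L`):
`m ≤ m_L(h)` — the T1 object «certified `d`-wave response at field `h`», lower edge. [cite: KomaTasaki1994, §1] -/
def PinFieldResponseFloorAt (tp U μ h : ℝ) (q L₀ : ℕ) (m : ℚ) : Prop :=
  ∀ (L : ℕ) [NeZero L], L₀ ≤ L → q ∣ L → PinFieldTorusResponseFloor L tp U μ h m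

/-- **Response CEILING leaf at field `h`**: `m_L(h) ≤ M` on every side `L ≥ L₀` with `q ∣ L`. A ceiling; never
speaks to presence. [cite: KomaTasaki1994, §1] -/
def PinFieldResponseCeilingAt (tp U μ h : ℝ) (q L₀ : ℕ) (M : ℚ) : Prop :=
  ∀ (L : ℕ) [NeZero L], L₀ ≤ L → q ∣ L → PinFieldTorusResponseCeiling L tp U μ h M

/-- **Two-sided response WINDOW at field `h`**: floor `m` and ceiling `M` on the same sides. [cite: KomaTasaki1994, §1] -/
def PinFieldResponseWindowAt (tp U μ h : ℝ) (q L₀ : ℕ) (m M : ℚ) : Prop :=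
  PinFieldResponseFloorAt tp U μ h q L₀ m ∧ PinFieldResponseCeilingAt tp U μ h q L₀ M

variable {L : ℕ} [NeZero L] {tp U μ h : ℝ} {q q' L₀ L₀' : ℕ} {m m' M M' : ℚ}

/-- Monotone transport of the floor slot. -/
theorem PinFieldResponseFloorAt.mono (hF : PinFieldResponseFloorAt tp U μ h q L₀ m) (hm : m' ≤ m)
    (hL : L₀ ≤ L₀') (hq : q ∣ q') : PinFieldResponseFloorAt tp U μ h q' L₀' m' :=
  fun L _ hL' hq' => le_trans (by exact_mod_cast hm) (hF L (hL.trans hL') (hq.trans hq'))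

/-- Monotone transport of the ceiling slot. -/
theorem PinFieldResponseCeilingAt.mono (hC : PinFieldResponseCeilingAt tp U μ h q L₀ M) (hM : M ≤ M')
    (hL : L₀ ≤ L₀') (hq : q ∣ q') : PinFieldResponseCeilingAt tp U μ h q' L₀' M' :=
  fun L _ hL' hq' => le_trans (hC L (hL.trans hL') (hq.trans hq')) (by exact_mod_cast hM)

/-- **Fast layer in `h`, floors move UP**: a floor at `h` is a floor at every `h' ≥ h` (`m_L` is non-decreasing). -/
theorem PinFieldResponseFloorAt.mono_field (hF : PinFieldResponseFloorAt tp U μ h q L₀ m) {h' : ℝ} (hle : h ≤ h') :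
    PinFieldResponseFloorAt tp U μ h' q L₀ m :=
  fun L _ hL hqL => le_trans (hF L hL hqL) (dWaveSourceDensityTT'_mono tp U μ hle)

/-- **Fast layer in `h`, ceilings move DOWN**: a ceiling at `h` is a ceiling at every `h' ≤ h`. -/
theorem PinFieldResponseCeilingAt.anti_field (hC : PinFieldResponseCeilingAt tp U μ h q L₀ M) {h' : ℝ}
    (hle : h' ≤ h) : PinFieldResponseCeilingAt tp U μ h' q L₀ M :=
  fun L _ hL hqL => le_trans (dWaveSourceDensityTT'_mono tp U μ hle) (hC L hL hqL)

/-- A-priori floor: `0 ≤ m_L(h)` for `h ≥ 0` on every side (no certificate). -/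
theorem PinFieldResponseFloorAt.zero (tp U μ : ℝ) {h : ℝ} (hh : 0 ≤ h) (q L₀ : ℕ) :
    PinFieldResponseFloorAt tp U μ h q L₀ 0 :=
  fun L _ _ _ => by
    unfold PinFieldTorusResponseFloor
    exact_mod_cast dWaveSourceDensityTT'_nonneg tp U μ hh

/-- CONSISTENCY: a floor slot never exceeds a ceiling slot on the same sides (`q ≠ 0`; at `q = 0` every
uniform row is vacuous beyond `L = 0` and no literal should be read from it). -/
theorem PinFieldResponseFloorAt.le_of_ceilingAt (hF : PinFieldResponseFloorAt tp U μ h q L₀ m)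
    (hC : PinFieldResponseCeilingAt tp U μ h q L₀' M) (hq : 0 < q) : m ≤ M := by
  -- the side `L = q · (max L₀ L₀' + 1)` is admissible for both rows
  set L := q * (max L₀ L₀' + 1) with hLdef
  have hLpos : 0 < L := Nat.mul_pos hq (Nat.succ_pos _)
  haveI : NeZero L := ⟨hLpos.ne'⟩
  have hge : max L₀ L₀' + 1 ≤ L := by
    rw [hLdef]; exact Nat.le_mul_of_pos_left _ hq
  have h1 := hF L (by omega) ⟨_, rfl⟩
  have h2 := hC L (by omega) ⟨_, rfl⟩
  unfold PinFieldTorusResponseFloor at h1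
  unfold PinFieldTorusResponseCeiling at h2
  exact_mod_cast h1.trans h2

end Leaves

/-! ### §2 The Hellmann–Feynman CHORDS at row level: energy rows at two fields ⇒ a response leaf -/

section Chords

variable {L : ℕ} [NeZero L] {tp U μ : ℝ}

/-- Bridge to the energy FLOOR cell of `Rows/SourcedTorusRows` (stated there under the torus files' local
`DecidableEq (FermionTorus 2 L) := LinearOrder.toDecidableEq`; the two `Matrix.groundEnergy` instance arguments
agree by `Subsingleton.elim`, discharged by `congr!`). -/
theorem sourcedTorusEnergyLowerRow_iff {h : ℝ} {e : ℚ} :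
    SourcedTorusEnergyLowerRow L tp U μ h e ↔
      ((e : ℚ) : ℝ) * (L : ℝ) ^ 2 ≤ (dWaveSourceTorusTT' L tp U μ h).groundEnergy := by
  unfold SourcedTorusEnergyLowerRow
  exact Iff.of_eq (by congr! 2)

/-- Bridge to the energy CEILING cell of `Rows/SourcedTorusRows` (instance arguments by `congr!`). -/
theorem sourcedTorusEnergyUpperRow_iff {h : ℝ} {e : ℚ} :
    SourcedTorusEnergyUpperRow L tp U μ h e ↔
      (dWaveSourceTorusTT' L tp U μ h).groundEnergy ≤ ((e : ℚ) : ℝ) * (L : ℝ) ^ 2 := by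
  unfold SourcedTorusEnergyUpperRow
  exact Iff.of_eq (by congr! 2)

/-- **FLOOR chord, one torus**: a floor `lo·L² ≤ E_L(h₁)` at the smaller field and a cap `E_L(h) ≤ hi·L²` AT the
field, `h₁ < h`, give `m ≤ m_L(h)` for every `m` with `m·2(h − h₁) ≤ lo − hi` (left chord of the concave `E_L`).
Teeth iff `hi < lo`. [cite: KomaTasaki1994, §1] [cite: Griffiths1966, §II] -/
theorem PinFieldTorusResponseFloor.of_energyRows {h₁ h : ℝ} (hlt : h₁ < h) {lo hi m : ℚ}
    (hlo : SourcedTorusEnergyLowerRow L tp U μ h₁ lo) (hhi : SourcedTorusEnergyUpperRow L tp U μ h hi)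
    (hm : ((m : ℚ) : ℝ) * (2 * (h - h₁)) ≤ lo - hi) : PinFieldTorusResponseFloor L tp U μ h m := by
  have hlo' := sourcedTorusEnergyLowerRow_iff.1 hlo
  have hhi' := sourcedTorusEnergyUpperRow_iff.1 hhi
  unfold PinFieldTorusResponseFloor
  have h1 := dWaveSourceDensityTT'_mul_le_groundEnergy_drop (L := L) tp U μ h h₁
  have hL := cast_sq_pos_of_neZero L
  have hδ : 0 < h - h₁ := sub_pos.2 hlt
  -- `(lo − hi)·L² ≤ E(h₁) − E(h) ≤ (h − h₁)·2L²·m_L(h)`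
  have hE : (((lo : ℚ) : ℝ) - hi) * (L : ℝ) ^ 2 ≤
      (dWaveSourceTorusTT' L tp U μ h₁).groundEnergy - (dWaveSourceTorusTT' L tp U μ h).groundEnergy := by
    rw [sub_mul]; exact sub_le_sub hlo' hhi'
  have hD : (dWaveSourceTorusTT' L tp U μ h₁).groundEnergy - (dWaveSourceTorusTT' L tp U μ h).groundEnergy ≤
      dWaveSourceDensityTT' L tp U μ h * ((2 * (h - h₁)) * (L : ℝ) ^ 2) := by
    have e : dWaveSourceDensityTT' L tp U μ h * ((2 * (h - h₁)) * (L : ℝ) ^ 2) =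
        -((h₁ - h) * (2 * (L : ℝ) ^ 2 * dWaveSourceDensityTT' L tp U μ h)) := by ring
    rw [e]; linarith
  have key : ((m : ℚ) : ℝ) * ((2 * (h - h₁)) * (L : ℝ) ^ 2) ≤
      dWaveSourceDensityTT' L tp U μ h * ((2 * (h - h₁)) * (L : ℝ) ^ 2) := by
    have e1 : ((m : ℚ) : ℝ) * ((2 * (h - h₁)) * (L : ℝ) ^ 2) = ((m : ℚ) : ℝ) * (2 * (h - h₁)) * (L : ℝ) ^ 2 := by
      ring
    rw [e1]
    exact (mul_le_mul_of_nonneg_right hm hL.le).trans (hE.trans hD)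
  exact le_of_mul_le_mul_right key (by positivity)

/-- **CEILING chord, one torus**: a cap `E_L(h) ≤ hi·L²` AT the field and a floor `lo·L² ≤ E_L(h₂)` at the larger
field, `h < h₂`, give `m_L(h) ≤ M` for every `M` with `hi − lo ≤ M·2(h₂ − h)` (right chord).
[cite: KomaTasaki1994, §1] [cite: Griffiths1966, §II] -/
theorem PinFieldTorusResponseCeiling.of_energyRows {h h₂ : ℝ} (hlt : h < h₂) {hi lo M : ℚ}
    (hhi : SourcedTorusEnergyUpperRow L tp U μ h hi) (hlo : SourcedTorusEnergyLowerRow L tp U μ h₂ lo)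
    (hM : ((hi : ℚ) : ℝ) - lo ≤ ((M : ℚ) : ℝ) * (2 * (h₂ - h))) : PinFieldTorusResponseCeiling L tp U μ h M := by
  have hlo' := sourcedTorusEnergyLowerRow_iff.1 hlo
  have hhi' := sourcedTorusEnergyUpperRow_iff.1 hhi
  unfold PinFieldTorusResponseCeiling
  have h1 := dWaveSourceDensityTT'_mul_le_groundEnergy_drop (L := L) tp U μ h h₂
  have hL := cast_sq_pos_of_neZero L
  have hδ : 0 < h₂ - h := sub_pos.2 hlt
  have hE : (dWaveSourceTorusTT' L tp U μ h).groundEnergy - (dWaveSourceTorusTT' L tp U μ h₂).groundEnergy ≤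
      (((hi : ℚ) : ℝ) - lo) * (L : ℝ) ^ 2 := by
    rw [sub_mul]; exact sub_le_sub hhi' hlo'
  have hD : dWaveSourceDensityTT' L tp U μ h * ((2 * (h₂ - h)) * (L : ℝ) ^ 2) ≤
      (dWaveSourceTorusTT' L tp U μ h).groundEnergy - (dWaveSourceTorusTT' L tp U μ h₂).groundEnergy := by
    have e : dWaveSourceDensityTT' L tp U μ h * ((2 * (h₂ - h)) * (L : ℝ) ^ 2) =
        (h₂ - h) * (2 * (L : ℝ) ^ 2 * dWaveSourceDensityTT' L tp U μ h) := by ring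
    rw [e]; exact h1
  have key : dWaveSourceDensityTT' L tp U μ h * ((2 * (h₂ - h)) * (L : ℝ) ^ 2) ≤
      ((M : ℚ) : ℝ) * ((2 * (h₂ - h)) * (L : ℝ) ^ 2) := by
    have e1 : ((M : ℚ) : ℝ) * ((2 * (h₂ - h)) * (L : ℝ) ^ 2) = ((M : ℚ) : ℝ) * (2 * (h₂ - h)) * (L : ℝ) ^ 2 := by
      ring
    rw [e1]
    exact hD.trans (hE.trans (mul_le_mul_of_nonneg_right hM hL.le))
  exact le_of_mul_le_mul_right key (by positivity)

variable {q L₀ L₁ : ℕ}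

/-- **FLOOR chord, menu form** (T1 lower edge): `SourcedEnergyLowerRow` at `h₁` and `SourcedEnergyUpperRow` AT
`h > h₁` on the same side progression `q` give the floor leaf `PinFieldResponseFloorAt … h q (max L₀ L₁) m` for
every `m` with `m·2(h − h₁) ≤ lo − hi`. The cap must be a cap of the SOURCED problem at `h`; a cap inherited from
a smaller field never gives teeth (`floorSlot_nonpos_of_transported_cap`). [cite: KomaTasaki1994, §1] -/
theorem PinFieldResponseFloorAt.of_energyRows {h₁ h : ℝ} (hlt : h₁ < h) {lo hi m : ℚ}
    (hlo : SourcedEnergyLowerRow tp U μ h₁ q L₀ lo) (hhi : SourcedEnergyUpperRow tp U μ h q L₁ hi)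
    (hm : ((m : ℚ) : ℝ) * (2 * (h - h₁)) ≤ lo - hi) :
    PinFieldResponseFloorAt tp U μ h q (max L₀ L₁) m :=
  fun L _ hL hqL => PinFieldTorusResponseFloor.of_energyRows hlt (hlo L ((le_max_left _ _).trans hL) hqL)
    (hhi L ((le_max_right _ _).trans hL) hqL) hm

/-- **CEILING chord, menu form**: `SourcedEnergyUpperRow` AT `h` and `SourcedEnergyLowerRow` at `h₂ > h` give the
ceiling leaf `PinFieldResponseCeilingAt … h q (max L₁ L₀) M` for every `M` with `hi − lo ≤ M·2(h₂ − h)`.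
[cite: KomaTasaki1994, §1] -/
theorem PinFieldResponseCeilingAt.of_energyRows {h h₂ : ℝ} (hlt : h < h₂) {hi lo M : ℚ}
    (hhi : SourcedEnergyUpperRow tp U μ h q L₁ hi) (hlo : SourcedEnergyLowerRow tp U μ h₂ q L₀ lo)
    (hM : ((hi : ℚ) : ℝ) - lo ≤ ((M : ℚ) : ℝ) * (2 * (h₂ - h))) :
    PinFieldResponseCeilingAt tp U μ h q (max L₁ L₀) M :=
  fun L _ hL hqL => PinFieldTorusResponseCeiling.of_energyRows hlt (hhi L ((le_max_left _ _).trans hL) hqL)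
    (hlo L ((le_max_right _ _).trans hL) hqL) hM

/-- **The three-field MENU node** (T1 two-sided): rows at `h₋ < h < h₊` — floor at `h₋`, cap at `h`, floor at `h₊`
— give the window leaf `[m, M]` at `h` whenever `m·2(h − h₋) ≤ lo₋ − hi` and `hi − lo₊ ≤ M·2(h₊ − h)`. On a
finite menu `0 = h₀ < h₁ < ⋯ < h_k` the best floor at `h_i` uses the best earlier field and the best ceiling the
best later field: each choice is one application of `of_energyRows`. [cite: KomaTasaki1994, §1] -/
theorem PinFieldResponseWindowAt.of_menu {hm h hp : ℝ} (hlo : hm < h) (hhi : h < hp) {lom hi lop m M : ℚ}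
    {Lm L₁ Lp : ℕ}
    (hrm : SourcedEnergyLowerRow tp U μ hm q Lm lom) (hrh : SourcedEnergyUpperRow tp U μ h q L₁ hi)
    (hrp : SourcedEnergyLowerRow tp U μ hp q Lp lop)
    (hm' : ((m : ℚ) : ℝ) * (2 * (h - hm)) ≤ lom - hi) (hM' : ((hi : ℚ) : ℝ) - lop ≤ ((M : ℚ) : ℝ) * (2 * (hp - h))) :
    PinFieldResponseWindowAt tp U μ h q (max (max Lm L₁) (max L₁ Lp)) m M :=
  ⟨(PinFieldResponseFloorAt.of_energyRows hlo hrm hrh hm').mono le_rfl (le_max_left _ _) dvd_rfl,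
    (PinFieldResponseCeilingAt.of_energyRows hhi hrh hrp hM').mono le_rfl (le_max_right _ _) dvd_rfl⟩

end Chords

/-! ### §3 The fast layer in `h` for the ENERGY rows, and the honesty node -/

section Transport

/-- The sourced energy is non-increasing in the field on `[0, ∞)`: `E_L(h) ≤ E_L(h₀)` for `0 ≤ h₀ ≤ h` (sandwich
`(h − h₀)·2L²·m_L(h₀) ≤ E_L(h₀) − E_L(h)` and `m_L(h₀) ≥ 0`). [cite: KomaTasaki1994, §1] -/
theorem groundEnergy_dWaveSourceTorusTT'_anti (L : ℕ) [NeZero L] (tp U μ : ℝ) {h₀ h : ℝ} (hh₀ : 0 ≤ h₀) (hle : h₀ ≤ h) :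
    (dWaveSourceTorusTT' L tp U μ h).groundEnergy ≤ (dWaveSourceTorusTT' L tp U μ h₀).groundEnergy := by
  have h1 := dWaveSourceDensityTT'_mul_le_groundEnergy_drop (L := L) tp U μ h₀ h
  have h2 := dWaveSourceDensityTT'_nonneg (L := L) tp U μ hh₀
  have h3 : 0 ≤ (h - h₀) * (2 * (L : ℝ) ^ 2 * dWaveSourceDensityTT' L tp U μ h₀) :=
    mul_nonneg (sub_nonneg.2 hle) (mul_nonneg (by positivity) h2)
  linarith

variable {L : ℕ} [NeZero L] {tp U μ : ℝ} {q L₀ : ℕ} {e : ℚ}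

/-- Caps move UP in the field: `E_L(h) ≤ E_L(h₀)` for `0 ≤ h₀ ≤ h`, so a cap at `h₀` is a cap at `h`. In particular
every source-FREE cap (`h₀ = 0`; e.g. a canonical cap by the Legendre inequality, §5) is a cap at every field.
[cite: KomaTasaki1994, §1] -/
theorem sourcedTorusEnergyUpperRow_mono_field {h₀ h : ℝ} (hrow : SourcedTorusEnergyUpperRow L tp U μ h₀ e)
    (hh₀ : 0 ≤ h₀) (hle : h₀ ≤ h) : SourcedTorusEnergyUpperRow L tp U μ h e :=
  sourcedTorusEnergyUpperRow_iff.2 ((groundEnergy_dWaveSourceTorusTT'_anti L tp U μ hh₀ hle).trans (sourcedTorusEnergyUpperRow_iff.1 hrow))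

/-- Floors move DOWN in the field: a floor at `h` is a floor at every `h₀ ∈ [0, h]`. [cite: KomaTasaki1994, §1] -/
theorem sourcedTorusEnergyLowerRow_anti_field {h₀ h : ℝ} (hrow : SourcedTorusEnergyLowerRow L tp U μ h e)
    (hh₀ : 0 ≤ h₀) (hle : h₀ ≤ h) : SourcedTorusEnergyLowerRow L tp U μ h₀ e :=
  sourcedTorusEnergyLowerRow_iff.2 ((sourcedTorusEnergyLowerRow_iff.1 hrow).trans (groundEnergy_dWaveSourceTorusTT'_anti L tp U μ hh₀ hle))

/-- Uniform form: caps move up in the field. [cite: KomaTasaki1994, §1] -/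
theorem sourcedEnergyUpperRow_mono_field {h₀ h : ℝ} (hrow : SourcedEnergyUpperRow tp U μ h₀ q L₀ e)
    (hh₀ : 0 ≤ h₀) (hle : h₀ ≤ h) : SourcedEnergyUpperRow tp U μ h q L₀ e :=
  fun L _ hL hqL => sourcedTorusEnergyUpperRow_mono_field (hrow L hL hqL) hh₀ hle

/-- Uniform form: floors move down in the field. [cite: KomaTasaki1994, §1] -/
theorem sourcedEnergyLowerRow_anti_field {h₀ h : ℝ} (hrow : SourcedEnergyLowerRow tp U μ h q L₀ e)
    (hh₀ : 0 ≤ h₀) (hle : h₀ ≤ h) : SourcedEnergyLowerRow tp U μ h₀ q L₀ e :=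
  fun L _ hL hqL => sourcedTorusEnergyLowerRow_anti_field (hrow L hL hqL) hh₀ hle

/-- **HONESTY NODE (the floor needs a SOURCED cap).** A floor slot at any field `h₁` never exceeds a cap slot at
a SMALLER field `h₀ ∈ [0, h₁]` — in particular a source-free cap: `lo(h₁) ≤ hi(0)`. [cite: KomaTasaki1994, §1] -/
theorem sourcedTorusEnergyLowerRow_le_upperRow_of_field_le {h₀ h₁ : ℝ} {lo hi : ℚ}
    (hlo : SourcedTorusEnergyLowerRow L tp U μ h₁ lo) (hhi : SourcedTorusEnergyUpperRow L tp U μ h₀ hi)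
    (hh₀ : 0 ≤ h₀) (hle : h₀ ≤ h₁) : lo ≤ hi :=
  (sourcedTorusEnergyLowerRow_anti_field hlo hh₀ hle).le_of_upperRow hhi

/-- The honesty node read on the floor chord: with rows `lo(h₁)`, `hi(h₀)`, `0 ≤ h₀ ≤ h₁ < h` (the cap at `h` being
the transported `hi(h₀)`), the chord condition `m·2(h − h₁) ≤ lo − hi` admits only `m ≤ 0`: the T1 floor has
teeth only with a cap of the SOURCED problem AT `h` certified strictly below the certified floor at `h₁`
(a pinned variational state; the pilots' / upper crew's object). [cite: KomaTasaki1994, §1] -/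
theorem floorSlot_nonpos_of_transported_cap {h₀ h₁ h : ℝ} {lo hi m : ℚ}
    (hlo : SourcedTorusEnergyLowerRow L tp U μ h₁ lo) (hhi : SourcedTorusEnergyUpperRow L tp U μ h₀ hi)
    (hh₀ : 0 ≤ h₀) (hle : h₀ ≤ h₁) (hlt : h₁ < h) (hm : ((m : ℚ) : ℝ) * (2 * (h - h₁)) ≤ lo - hi) : m ≤ 0 := by
  have hcons : ((lo : ℚ) : ℝ) ≤ hi := by
    exact_mod_cast sourcedTorusEnergyLowerRow_le_upperRow_of_field_le hlo hhi hh₀ hle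
  have hδ : 0 < 2 * (h - h₁) := by linarith
  have h0 : ((m : ℚ) : ℝ) * (2 * (h - h₁)) ≤ 0 * (2 * (h - h₁)) := by rw [zero_mul]; linarith
  exact_mod_cast le_of_mul_le_mul_right h0 hδ

end Transport

end Summit.Ventures.CertifiedManyBodySolver.Observables

end
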